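import Summits.AnomalousDissipation.AnomalousDissipation.Theorems.SolenoidalFractalHomogenisationRealisedQuasiStaticCellLawSingleMode
import HarnessLib

/-!
# K2R `RealisedQuasiStaticCellLaw`, line `floquet-bloch`, stub `stub_upperSome`: the Galerkin data of the single-mode
# datum (helper; `--supports stmt-AnomalousDissipation-20446`)

Summits-side helper file (everything proved; no definitions, no named facts). For the single-mode datum
`w₀ = Re(e_ℓ)p` (`ℓ ≠ 0`) and any passive-vector Galerkin set-up `h` over it: at `t = 0` the Galerkin coefficients
(`α_N(0) = P_N ŵ₀`) are `α_N(0)(ℓ) = ½p`, `α_N(0)(k) = 0` off `±ℓ`, so that `‖α_N(0)(ℓ)‖² = ‖p‖²/4` and the truncated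
energy is `Σ_{k ∈ ball} ‖α_N(0)(k)‖² = 2‖α_N(0)(ℓ)‖²` (no fast energy at `t = 0`), and `∫‖w₀‖² ≤ ‖p‖²`. These are the
data inputs `hx0`, `hcone0` of `upperSome_galerkin_lower` and the prefactor comparison of `stub_upperSome`.
This is NOT a proof of Onsager's conjecture nor of anomalous dissipation.
-/

set_option linter.dupNamespace false

noncomputable section

namespace Summit.AnomalousDissipation.AnomalousDissipation.Theorems.SolenoidalFractalHomogenisation.RealisedQuasiStaticCellLaw

open MeasureTheory
open scoped InnerProductSpace
open Literature.Analysis Literature.Analysis.FunctionSpaces Literature.Analysis.FunctionSpaces.Torus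
open Literature.Analysis.FluidPDE Literature.Analysis.FluidPDE.Torus Literature.Analysis.FluidPDE.LatticeShear

variable {κ : ℝ} {b : ℝ → UnitAddTorus (Fin 3) → EuclideanSpace ℝ (Fin 3)} {B : Finset (Fin 3 → ℤ)}
  {β : ℝ → (Fin 3 → ℤ) → EuclideanSpace ℂ (Fin 3)} {C : ℝ} {Sec : Set (Fin 3 → ℤ)}
  {ℓ : Fin 3 → ℤ} {p : EuclideanSpace ℝ (Fin 3)}

/-- The Galerkin coefficients at `t = 0` are the Fourier coefficients of the datum on the ball. -/
theorem galerkinCoeffAt_zero_of_mem {w₀ : UnitAddTorus (Fin 3) → EuclideanSpace ℝ (Fin 3)}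
    (h : PVSetup κ b B β C Sec w₀) {N : ℕ} {k : Fin 3 → ℤ} (hk : k ∈ freqBall N) :
    h.galerkinCoeffAt N 0 k = UnitAddTorus.mFourierCoeff (EuclideanSpace.complexify ∘ w₀) k := by
  rw [PVSetup.galerkinCoeffAt, coeffExt_of_mem _ hk, (h.galerkinCoeff_spec N).1]
  rfl

/-- `α_N(0)(ℓ) = ½p` for the single-mode datum. -/
theorem singleMode_galerkinCoeffAt_zero_self (hℓ : ℓ ≠ 0)
    (h : PVSetup κ b B β C Sec (fun x : UnitAddTorus (Fin 3) => (UnitAddTorus.mFourier ℓ x).re • p))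
    {N : ℕ} (hN : ℓ ∈ freqBall N) :
    h.galerkinCoeffAt N 0 ℓ = (2 : ℂ)⁻¹ • EuclideanSpace.complexify p := by
  have hne : ℓ ≠ -ℓ := fun e => hℓ (by
    have : (2 : ℤ) • ℓ = 0 := by rw [two_smul]; nth_rewrite 2 [e]; exact add_neg_cancel ℓ
    funext i
    have hi := congrFun this i
    simp only [Pi.smul_apply, smul_eq_mul, Pi.zero_apply, mul_eq_zero, OfNat.ofNat_ne_zero, false_or] at hi
    exact hi)
  rw [galerkinCoeffAt_zero_of_mem h hN, singleMode_eq_realTrigPoly, mFourierCoeff_realTrigPoly_singleton, if_pos rfl,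
    if_neg hne, EuclideanSpace.conjVec_zero, add_zero]

/-- `α_N(0)(k) = 0` off `±ℓ` for the single-mode datum. -/
theorem singleMode_galerkinCoeffAt_zero_of_ne
    (h : PVSetup κ b B β C Sec (fun x : UnitAddTorus (Fin 3) => (UnitAddTorus.mFourier ℓ x).re • p))
    (N : ℕ) {k : Fin 3 → ℤ} (hk : k ≠ ℓ) (hk' : k ≠ -ℓ) : h.galerkinCoeffAt N 0 k = 0 := by
  by_cases hkN : k ∈ freqBall N
  · rw [galerkinCoeffAt_zero_of_mem h hkN]
    exact mFourierCoeff_singleMode_eq_zero ℓ p hk hk'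
  · rw [PVSetup.galerkinCoeffAt, coeffExt_of_not_mem _ hkN]

/-- `‖α_N(0)(ℓ)‖² = ‖p‖²/4`. -/
theorem singleMode_galerkin_norm_sq_zero (hℓ : ℓ ≠ 0)
    (h : PVSetup κ b B β C Sec (fun x : UnitAddTorus (Fin 3) => (UnitAddTorus.mFourier ℓ x).re • p))
    {N : ℕ} (hN : ℓ ∈ freqBall N) :
    ‖h.galerkinCoeffAt N 0 ℓ‖ ^ 2 = ‖p‖ ^ 2 / 4 := by
  rw [singleMode_galerkinCoeffAt_zero_self hℓ h hN, norm_smul, norm_inv, EuclideanSpace.norm_complexify]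
  simp
  ring

/-- **No fast energy at `t = 0`**: `Σ_{k ∈ ball} ‖α_N(0)(k)‖² = 2‖α_N(0)(ℓ)‖²`. -/
theorem singleMode_galerkin_energy_zero (hℓ : ℓ ≠ 0)
    (h : PVSetup κ b B β C Sec (fun x : UnitAddTorus (Fin 3) => (UnitAddTorus.mFourier ℓ x).re • p))
    {N : ℕ} (hN : ℓ ∈ freqBall N) :
    ∑ k ∈ freqBall N, ‖h.galerkinCoeffAt N 0 k‖ ^ 2 = 2 * ‖h.galerkinCoeffAt N 0 ℓ‖ ^ 2 := by
  have hne : ℓ ≠ -ℓ := fun e => hℓ (by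
    have : (2 : ℤ) • ℓ = 0 := by rw [two_smul]; nth_rewrite 2 [e]; exact add_neg_cancel ℓ
    funext i
    have hi := congrFun this i
    simp only [Pi.smul_apply, smul_eq_mul, Pi.zero_apply, mul_eq_zero, OfNat.ofNat_ne_zero, false_or] at hi
    exact hi)
  rw [Finset.sum_eq_add_of_mem ℓ (-ℓ) hN (neg_mem_freqBall_of_mem ℓ hN) hne fun k _ hk =>
    by rw [singleMode_galerkinCoeffAt_zero_of_ne h N hk.1 hk.2, norm_zero, zero_pow two_ne_zero]]
  rw [h.isConjSymm_galerkinCoeffAt N 0 ℓ, EuclideanSpace.norm_conjVec]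
  ring

/-- `∫‖w₀‖² ≤ ‖p‖²` for the single-mode datum. -/
theorem integral_norm_sq_singleMode_le (ℓ : Fin 3 → ℤ) (p : EuclideanSpace ℝ (Fin 3)) :
    ∫ x, ‖(UnitAddTorus.mFourier ℓ x).re • p‖ ^ 2 ≤ ‖p‖ ^ 2 := by
  have h := integral_norm_sq_realTrigPoly_singleton_le ℓ (fun _ => EuclideanSpace.complexify p)
  rw [← singleMode_eq_realTrigPoly, EuclideanSpace.norm_complexify] at h
  exact h

end Summit.AnomalousDissipation.AnomalousDissipation.Theorems.SolenoidalFractalHomogenisation.RealisedQuasiStaticCellLaw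

end
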